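import Summits.NavierStokesRegularity.NavierStokesRegularity.Theorems.AxisymmetricExtremalityAxisymmetricKatoGlobalStubSeregin2020TypeIILemma22ExcisionGradError
import Summits.NavierStokesRegularity.NavierStokesRegularity.Theorems.AxisymmetricExtremalityAxisymmetricKatoGlobalStubSeregin2020TypeIILemma22ExcisionDriftError
import Summits.NavierStokesRegularity.NavierStokesRegularity.Theorems.AxisymmetricExtremalityAxisymmetricKatoGlobalStubSeregin2020TypeIILemma22ExcisionAxisError
import Summits.NavierStokesRegularity.NavierStokesRegularity.Theorems.AxisymmetricExtremalityAxisymmetricKatoGlobalStubSeregin2020TypeIILemma22ExcisionSchedule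
import Summits.NavierStokesRegularity.NavierStokesRegularity.Theorems.AxisymmetricExtremalityAxisymmetricKatoGlobalStubSeregin2020TypeIILemma22ErrorPackageTools
import Summits.NavierStokesRegularity.NavierStokesRegularity.Theorems.AxisymmetricExtremalityAxisymmetricKatoGlobalStubSeregin2020TypeIILemma22CutTelescoping
import HarnessLib

/-!
# L22-B, piece F3c (9/·): the excision-error package

Seregin 2020 Lemma 2.2 ⇐ N–U 2012 Lemma 4.2 for the class `𝒱` (cell ns-inputs, kit A1-L22B-F3).
`excisionError_package` discharges the hypothesis `hErr` of
`energyClass_acrossAxis_of_classV_of_excisionErrors`: for the normalised pair `(Φ̃, Ũ)` of the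
class-`𝒱` data and every admissible `(H, Θ, η, t₁, t₂)` there is a modulus `ω(ε) → 0` (`ε → 0⁺`) such
that for every finite cylinder cover with radii `rᵢ ∈ ]0,1[`, `∑ rᵢ ≤ ε`, every increasing time
partition `τ` of `[t₁,t₂]`, active sets `A m` and ball-bump cut-offs `φ m = ∏_{i∈A m}(1-ψᵢ)`, the three
excision-error integrands are integrable on each piece and their sums over the pieces are `≤ ω(ε)`.
Inputs of record: (e1) `excision_gradError_le` (es-p1), (e2) `excision_driftError_le` and
(e3) `excision_axisError_le` (ser-c), the accounting `sum_steps_active_weight_le` (es-p1); the drift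
sum is closed with the integrated Young bound `∫|Ũ| ≤ r²∫|Ũ|³ + r⁻¹·vol` on `[tᵢ-2rᵢ²,tᵢ+2rᵢ²] × B(xᵢ,4rᵢ)`
(volume `≤ 256|B(0,1)| rᵢ⁵`), giving `ω(ε) = (4K₁ε + K₂(W+256|B(0,1)|) + 4K₃) ε`.
[cite: NazarovUraltseva2012, §3 (3.9), Remark 9]

Nothing here is a Navier–Stokes regularity statement.
-/

noncomputable section

set_option linter.dupNamespace false

open MeasureTheory Set Function Filter Topology TopologicalSpace Metric
open scoped NNReal ENNReal InnerProductSpace RealInnerProductSpace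

namespace Summit.NavierStokesRegularity.NavierStokesRegularity.Theorems.AxisymmetricKatoGlobal.EulerScaling

open Literature.Analysis.FluidPDE Literature.Analysis.FluidPDE.Seregin2020

/-- **The excision-error package** (module docstring). -/
theorem excisionError_package
    {U U' : ℝ → EuclideanSpace ℝ (Fin 3) → EuclideanSpace ℝ (Fin 3)} {Φ Φ' : ℝ → EuclideanSpace ℝ (Fin 3) → ℝ}
    {S : Set (ℝ × EuclideanSpace ℝ (Fin 3))} {R k : ℝ}
    (hUc : ContinuousOn (uncurry U) {z : ℝ × EuclideanSpace ℝ (Fin 3) | z.1 < 0 ∧ cylRadius z.2 ≠ 0})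
    (hU3 : ∀ a : ℝ, 0 < a → ∫⁻ z in parabolicCylinder a (0 : ℝ × EuclideanSpace ℝ (Fin 3)), ‖U z.1 z.2‖ₑ ^ (3 : ℕ) < ∞)
    (hSc : IsClosed S)
    (hΦc : ContinuousOn (uncurry Φ) ({z : ℝ × EuclideanSpace ℝ (Fin 3) | z.1 < 0} \ S))
    (hΦ0 : ∀ z : ℝ × EuclideanSpace ℝ (Fin 3), z.1 < 0 → z ∉ S → 0 ≤ Φ z.1 z.2) (hR : 0 < R) (hk0 : 0 < k)
    (hΦ'1 : ∀ t x, t < 0 → (t, x) ∉ S → Φ' t x = Φ t x) (hΦ'2 : ∀ t x, ¬ (t < 0 ∧ (t, x) ∉ S) → Φ' t x = k)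
    (hU'1 : ∀ t x, t < 0 → cylRadius x ≠ 0 → U' t x = U t x) (hU'2 : ∀ t x, ¬ (t < 0 ∧ cylRadius x ≠ 0) → U' t x = 0) :
    ∀ (H : ℝ → ℝ), ContDiff ℝ 2 H → (∀ v, deriv H v ≤ 0) → (∀ v, 0 ≤ H v) → (∀ v, k ≤ v → H v = 0) →
      ∀ (Θ : EuclideanSpace ℝ (Fin 3) → ℝ), ContDiff ℝ 1 Θ → HasCompactSupport Θ →
        tsupport Θ ⊆ ball (0 : EuclideanSpace ℝ (Fin 3)) (2 * R) →
      ∀ (η : ℝ → ℝ), ContDiff ℝ 1 η → (∀ s, 0 ≤ η s) →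
      ∀ (t₁ t₂ : ℝ), -R ^ 2 < t₁ → t₁ ≤ t₂ → t₂ < 0 →
      ∃ ω : ℝ → ℝ, Tendsto ω (𝓝[>] 0) (𝓝 0) ∧
        ∀ (s : Finset ℕ) (z : ℕ → ℝ × EuclideanSpace ℝ (Fin 3)) (r : ℕ → ℝ) (ε : ℝ), 0 < ε →
          (∀ i ∈ s, 0 < r i ∧ r i < 1) → ∑ i ∈ s, r i ≤ ε →
        ∀ (p : ℕ) (τ : ℕ → ℝ), Monotone τ → τ 0 = t₁ → τ p = t₂ →
        ∀ (A : ℕ → Finset ℕ), (∀ m, A m = s.filter fun i => (z i).1 - 2 * r i ^ 2 ≤ τ m ∧ τ (m + 1) ≤ (z i).1 + 2 * r i ^ 2) →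
        ∀ (φ : ℕ → EuclideanSpace ℝ (Fin 3) → ℝ), (∀ m y, φ m y = ∏ i ∈ A m, (1 - cutoff (2 * r i) (y - (z i).2))) →
          (∀ m < p,
            Integrable (fun w : ℝ × EuclideanSpace ℝ (Fin 3) =>
                η w.1 * (H (Φ' w.1 w.2) * (Θ w.2 ^ 2 * ‖gradient (φ m) w.2‖ ^ 2)))
              (volume.restrict (Icc (τ m) (τ (m + 1)) ×ˢ (univ : Set (EuclideanSpace ℝ (Fin 3))))) ∧
            Integrable (fun w : ℝ × EuclideanSpace ℝ (Fin 3) =>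
                η w.1 * (H (Φ' w.1 w.2) * inner ℝ (U' w.1 w.2) ((Θ w.2 ^ 2) • gradient (fun y => φ m y ^ 2) w.2)))
              (volume.restrict (Icc (τ m) (τ (m + 1)) ×ˢ (univ : Set (EuclideanSpace ℝ (Fin 3))))) ∧
            Integrable (fun w : ℝ × EuclideanSpace ℝ (Fin 3) =>
                η w.1 * (2 / cylRadius w.2 * (H (Φ' w.1 w.2) * (Θ w.2 ^ 2 * fderiv ℝ (fun y => φ m y ^ 2) w.2 (eR w.2)))))
              (volume.restrict (Icc (τ m) (τ (m + 1)) ×ˢ (univ : Set (EuclideanSpace ℝ (Fin 3)))))) ∧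
          (∑ m ∈ Finset.range p, ∫ w in Icc (τ m) (τ (m + 1)) ×ˢ (univ : Set (EuclideanSpace ℝ (Fin 3))),
              η w.1 * (H (Φ' w.1 w.2) * (Θ w.2 ^ 2 * ‖gradient (φ m) w.2‖ ^ 2))) ≤ ω ε ∧
          (∑ m ∈ Finset.range p, ∫ w in Icc (τ m) (τ (m + 1)) ×ˢ (univ : Set (EuclideanSpace ℝ (Fin 3))),
              η w.1 * (H (Φ' w.1 w.2) * |inner ℝ (U' w.1 w.2) ((Θ w.2 ^ 2) • gradient (fun y => φ m y ^ 2) w.2)|)) ≤ ω ε ∧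
          (∑ m ∈ Finset.range p, ∫ w in Icc (τ m) (τ (m + 1)) ×ˢ (univ : Set (EuclideanSpace ℝ (Fin 3))),
              η w.1 * (2 / cylRadius w.2 * (H (Φ' w.1 w.2) * |Θ w.2 ^ 2 * fderiv ℝ (fun y => φ m y ^ 2) w.2 (eR w.2)|))) ≤ ω ε := by
  classical
  intro H hH hH' hH0 hHk Θ hΘ hΘc hΘO η hη hη0 t₁ t₂ ht₁ h12 ht₂
  -- ### the normalised pair: measurability, sign, size
  have hΦ'm : Measurable (uncurry Φ') := measurable_uncurry_normalised hSc hΦc hΦ'1 hΦ'2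
  have hΦ'0 : ∀ t x, 0 ≤ Φ' t x := normalised_nonneg hΦ0 hk0 hΦ'1 hΦ'2
  have hU'm : AEStronglyMeasurable (uncurry U') volume := aestronglyMeasurable_uncurry_normalisedU hUc hU'1 hU'2
  have hU3' := lintegral_cube_normalisedU_lt_top hU3 hU'1 hU'2 hR ht₁ ht₂
  -- ### constants
  obtain ⟨C₀, hC₀, hbump⟩ := exists_ballBump_const
  obtain ⟨K₁, hK₁, hE1⟩ := excision_gradError_le (R := R) (t₁ := t₁) (t₂ := t₂) hΦ'm hΦ'0 hH hH' hH0 hΘ hΘc hΘO hη hC₀.le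
  obtain ⟨K₂, hK₂, hE2⟩ := excision_driftError_le (t₁ := t₁) (t₂ := t₂) hU'm hU3' hΦ'm hΦ'0 hH hH' hH0 hΘ hΘc hΘO hη hC₀.le
  obtain ⟨K₃, hK₃, hE3⟩ := excision_axisError_le (t₁ := t₁) (t₂ := t₂) hΦ'm hΦ'0 hH hH' hH0 hΘ hΘc hη hC₀.le
  set W : ℝ := (∫⁻ w in Icc t₁ t₂ ×ˢ ball (0 : EuclideanSpace ℝ (Fin 3)) (2 * R), ‖U' w.1 w.2‖ₑ ^ (3 : ℕ)).toReal with hW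
  have hW0 : 0 ≤ W := ENNReal.toReal_nonneg
  set vB : ℝ := volume.real (ball (0 : EuclideanSpace ℝ (Fin 3)) 1) with hvB
  have hvB0 : 0 ≤ vB := measureReal_nonneg
  set ω : ℝ → ℝ := fun ε => (4 * K₁ * ε + K₂ * (W + 256 * vB) + 4 * K₃) * ε with hωdef
  refine ⟨ω, ?_, ?_⟩
  · have hc : Continuous ω := by rw [hωdef]; fun_prop
    have h0 : ω 0 = 0 := by simp [hωdef]
    simpa [h0] using (hc.tendsto 0).mono_left nhdsWithin_le_nhds
  intro s z r ε hε hr hsum p τ hτ hτ0 hτp A hA φ hφ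
  -- ### the bumps of this cover
  set ψ : ℕ → EuclideanSpace ℝ (Fin 3) → ℝ := fun i y => cutoff (2 * r i) (y - (z i).2) with hψ
  have hφf : ∀ m, φ m = fun y => ∏ i ∈ A m, (1 - ψ i y) := fun m => funext (hφ m)
  have hAs : ∀ m, A m ⊆ s := fun m => by rw [hA m]; exact Finset.filter_subset _ _
  have hrA : ∀ m, ∀ i ∈ A m, 0 < r i := fun m i hi => (hr i (hAs m hi)).1
  have hψC : ∀ m, ∀ i ∈ A m, ContDiff ℝ 1 (ψ i) := fun m i hi => (hbump (z i).2 (r i) (hrA m i hi)).1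
  have hψ01 : ∀ m, ∀ i ∈ A m, ∀ y, 0 ≤ ψ i y ∧ ψ i y ≤ 1 := fun m i hi => (hbump (z i).2 (r i) (hrA m i hi)).2.1
  have hψD : ∀ m, ∀ i ∈ A m, ∀ y, ‖fderiv ℝ (ψ i) y‖ ≤ C₀ / r i :=
    fun m i hi => (hbump (z i).2 (r i) (hrA m i hi)).2.2.2.2.1
  have hψD0 : ∀ m, ∀ i ∈ A m, ∀ y, y ∉ ball (z i).2 (4 * r i) → fderiv ℝ (ψ i) y = 0 :=
    fun m i hi => (hbump (z i).2 (r i) (hrA m i hi)).2.2.2.2.2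
  -- ### the pieces
  have hτa : ∀ m, t₁ ≤ τ m := fun m => by rw [← hτ0]; exact hτ (Nat.zero_le m)
  have hτb : ∀ m < p, τ (m + 1) ≤ t₂ := fun m hm => by rw [← hτp]; exact hτ hm
  have hτab : ∀ m, τ m ≤ τ (m + 1) := fun m => hτ (Nat.le_succ m)
  have G1 : ∀ m < p, _ := fun m hm => hE1 (A m) (fun i => (z i).2) r ψ (τ m) (τ (m + 1)) (hτa m) (hτab m) (hτb m hm)
    (hrA m) (hψC m) (hψ01 m) (hψD m) (hψD0 m)
  have G2 : ∀ m < p, _ := fun m hm => hE2 (A m) (fun i => (z i).2) r ψ (τ m) (τ (m + 1)) (hτa m) (hτab m) (hτb m hm)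
    (hrA m) (hψC m) (hψ01 m) (hψD m) (hψD0 m)
  have G3 : ∀ m < p, _ := fun m hm => hE3 (A m) (fun i => (z i).2) r ψ (τ m) (τ (m + 1)) (hτa m) (hτab m) (hτb m hm)
    (hrA m) (hψC m) (hψ01 m) (hψD m) (hψD0 m)
  have hφsq : ∀ m, (fun y => φ m y ^ 2) = fun y => (∏ i ∈ A m, (1 - ψ i y)) ^ 2 := fun m => funext fun y => by rw [hφ m y]
  refine ⟨fun m hm => ⟨?_, ?_, ?_⟩, ?_, ?_, ?_⟩
  · rw [hφf m]; exact (G1 m hm).1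
  · rw [hφsq m]; exact (G2 m hm).1
  · rw [hφsq m]; exact (G3 m hm).1
  · -- ### (e1): `Σ_m ∫ e₁ ≤ K₁ ε Σ_m |L_m| |A m| ≤ 4 K₁ ε Σ rᵢ² ≤ 4K₁ε²`
    have hstep : ∀ m ∈ Finset.range p, (∫ w in Icc (τ m) (τ (m + 1)) ×ˢ (univ : Set (EuclideanSpace ℝ (Fin 3))),
        η w.1 * (H (Φ' w.1 w.2) * (Θ w.2 ^ 2 * ‖gradient (φ m) w.2‖ ^ 2))) ≤
        K₁ * ε * ((τ (m + 1) - τ m) * ∑ i ∈ s.filter (fun i => (z i).1 - 2 * r i ^ 2 ≤ τ m ∧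
          τ (m + 1) ≤ (z i).1 + 2 * r i ^ 2), (1 : ℝ)) := by
      intro m hm
      have hm' := Finset.mem_range.1 hm
      have h := (G1 m hm').2
      rw [← hφf m] at h
      have hdd : ∑ i ∈ A m, ∑ j ∈ A m, min (r i) (r j) ^ 3 / (r i * r j) ≤ ∑ i ∈ A m, ε := by
        refine Finset.sum_le_sum fun i hi => ?_
        calc ∑ j ∈ A m, min (r i) (r j) ^ 3 / (r i * r j) ≤ ∑ j ∈ A m, r j :=
              Finset.sum_le_sum fun j hj => min_cube_div_le (hrA m i hi) (hrA m j hj)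
          _ ≤ ∑ j ∈ s, r j := Finset.sum_le_sum_of_subset_of_nonneg (hAs m) fun j hj _ => (hr j hj).1.le
          _ ≤ ε := hsum
      rw [Finset.sum_const, nsmul_eq_mul, mul_comm] at hdd
      rw [← hA m, Finset.sum_const, nsmul_eq_mul, mul_one]
      have hL : 0 ≤ τ (m + 1) - τ m := sub_nonneg.2 (hτab m)
      calc (∫ w in Icc (τ m) (τ (m + 1)) ×ˢ (univ : Set (EuclideanSpace ℝ (Fin 3))),
            η w.1 * (H (Φ' w.1 w.2) * (Θ w.2 ^ 2 * ‖gradient (φ m) w.2‖ ^ 2)))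
          ≤ ∫ w in Icc (τ m) (τ (m + 1)) ×ˢ (univ : Set (EuclideanSpace ℝ (Fin 3))),
            |η w.1 * (H (Φ' w.1 w.2) * (Θ w.2 ^ 2 * ‖gradient (φ m) w.2‖ ^ 2))| :=
            (le_abs_self _).trans abs_integral_le_integral_abs
        _ ≤ K₁ * (τ (m + 1) - τ m) * ∑ i ∈ A m, ∑ j ∈ A m, min (r i) (r j) ^ 3 / (r i * r j) := h
        _ ≤ K₁ * (τ (m + 1) - τ m) * (ε * (A m).card) := mul_le_mul_of_nonneg_left hdd (mul_nonneg hK₁ hL)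
        _ = K₁ * ε * ((τ (m + 1) - τ m) * (A m).card) := by ring
    refine (Finset.sum_le_sum hstep).trans ?_
    rw [← Finset.mul_sum]
    have hacc := sum_steps_active_weight_le hτ p s (fun i => (z i).1 - 2 * r i ^ 2) (fun i => (z i).1 + 2 * r i ^ 2)
      (fun i hi => by have := (hr i hi).1; nlinarith) (fun _ => (1 : ℝ)) (fun _ _ => zero_le_one)
    have h4 : ∑ i ∈ s, ((z i).1 + 2 * r i ^ 2 - ((z i).1 - 2 * r i ^ 2)) * (1 : ℝ) ≤ 4 * ε := by
      have : ∀ i ∈ s, ((z i).1 + 2 * r i ^ 2 - ((z i).1 - 2 * r i ^ 2)) * (1 : ℝ) ≤ 4 * r i := by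
        intro i hi; have h1 := (hr i hi).2; have h0 := (hr i hi).1; nlinarith
      refine (Finset.sum_le_sum this).trans ?_
      rw [← Finset.mul_sum]; linarith
    have hKε : 0 ≤ K₁ * ε := mul_nonneg hK₁ hε.le
    calc K₁ * ε * ∑ m ∈ Finset.range p, (τ (m + 1) - τ m) *
          ∑ i ∈ s.filter (fun i => (z i).1 - 2 * r i ^ 2 ≤ τ m ∧ τ (m + 1) ≤ (z i).1 + 2 * r i ^ 2), (1 : ℝ)
        ≤ K₁ * ε * (4 * ε) := mul_le_mul_of_nonneg_left (hacc.trans h4) hKε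
      _ ≤ ω ε := by
          rw [hωdef]
          have : 0 ≤ (K₂ * (W + 256 * vB) + 4 * K₃) * ε := by positivity
          nlinarith
  · -- ### (e2): drift errors `Σ_m ∫ |e₂| ≤ K₂ Σᵢ rᵢ⁻¹ ∫_{Gᵢ} ‖Ũ‖ ≤ K₂ (W + 256|B|) ε`
    -- the slab function and the per-ball sets
    set Bq : ℕ → Set (EuclideanSpace ℝ (Fin 3)) := fun i =>
      ball (z i).2 (4 * r i) ∩ ball (0 : EuclideanSpace ℝ (Fin 3)) (2 * R) with hBq
    set Ei : ℕ → Set ℝ := fun i => Icc ((z i).1 - 2 * r i ^ 2) ((z i).1 + 2 * r i ^ 2) with hEi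
    set g : ℕ → ℝ × EuclideanSpace ℝ (Fin 3) → ℝ := fun i w => (Ei i ×ˢ Bq i).indicator (fun w => ‖U' w.1 w.2‖) w with hg
    have hBqm : ∀ i, MeasurableSet (Bq i) := fun i => measurableSet_ball.inter measurableSet_ball
    have hEBm : ∀ i, MeasurableSet (Ei i ×ˢ Bq i) := fun i => measurableSet_Icc.prod (hBqm i)
    -- `Ũ` is integrable on `[t₁,t₂] × B(0,2R)`
    have hslab : volume (Icc t₁ t₂ ×ˢ ball (0 : EuclideanSpace ℝ (Fin 3)) (2 * R)) ≠ ⊤ := by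
      rw [show (volume : Measure (ℝ × EuclideanSpace ℝ (Fin 3))) = (volume : Measure ℝ).prod volume from rfl,
        Measure.prod_prod]
      exact ENNReal.mul_ne_top (by rw [Real.volume_Icc]; exact ENNReal.ofReal_ne_top) measure_ball_lt_top.ne
    have hUint : IntegrableOn (fun w : ℝ × EuclideanSpace ℝ (Fin 3) => U' w.1 w.2)
        (Icc t₁ t₂ ×ˢ ball (0 : EuclideanSpace ℝ (Fin 3)) (2 * R)) volume :=
      integrableOn_of_lintegral_cube_lt_top hU'm hU3' hslab
    have hgint : ∀ i, Integrable (g i) (volume.restrict (Icc t₁ t₂ ×ˢ (univ : Set (EuclideanSpace ℝ (Fin 3))))) := by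
      intro i
      rw [hg]
      have h1 : IntegrableOn (fun w : ℝ × EuclideanSpace ℝ (Fin 3) => ‖U' w.1 w.2‖)
          ((Ei i ×ˢ Bq i) ∩ (Icc t₁ t₂ ×ˢ (univ : Set (EuclideanSpace ℝ (Fin 3))))) volume := by
        refine IntegrableOn.mono_set (Integrable.norm hUint) ?_
        rintro w ⟨⟨-, hw2⟩, hw1, -⟩
        exact ⟨hw1, hw2.2⟩
      exact (integrableOn_indicator_iff (hEBm i)).2 h1
    -- per piece and ball: the piece integral is dominated by the slab integral of `gᵢ`
    have hpiece : ∀ m < p, ∀ i ∈ A m,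
        (∫ w in Icc (τ m) (τ (m + 1)) ×ˢ Bq i, ‖U' w.1 w.2‖) =
          ∫ w in Icc (τ m) (τ (m + 1)) ×ˢ (univ : Set (EuclideanSpace ℝ (Fin 3))), g i w := by
      intro m hm i hi
      have hact := (Finset.mem_filter.1 (by rw [← hA m]; exact hi)).2
      have hset : (Ei i ×ˢ Bq i) ∩ (Icc (τ m) (τ (m + 1)) ×ˢ (univ : Set (EuclideanSpace ℝ (Fin 3)))) =
          Icc (τ m) (τ (m + 1)) ×ˢ Bq i := by
        ext w
        simp only [mem_inter_iff, mem_prod, mem_univ, and_true, hEi, mem_Icc]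
        constructor
        · rintro ⟨⟨-, hB⟩, ht⟩; exact ⟨ht, hB⟩
        · rintro ⟨ht, hB⟩; exact ⟨⟨⟨hact.1.trans ht.1, ht.2.trans hact.2⟩, hB⟩, ht⟩
      rw [hg, integral_indicator (hEBm i), Measure.restrict_restrict (hEBm i), hset]
    have hsumg : ∀ i ∈ s, ∑ m ∈ Finset.range p,
        (if i ∈ A m then ∫ w in Icc (τ m) (τ (m + 1)) ×ˢ Bq i, ‖U' w.1 w.2‖ else 0) ≤
        ∫ w in Icc t₁ t₂ ×ˢ (univ : Set (EuclideanSpace ℝ (Fin 3))), g i w := by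
      intro i hi
      have hsplit := sum_setIntegral_Icc_prod_univ p τ (fun m _ => hτab m) (f := g i) (by rw [hτ0, hτp]; exact hgint i)
      rw [hτ0, hτp] at hsplit
      rw [← hsplit]
      refine Finset.sum_le_sum fun m hm => ?_
      have hm' := Finset.mem_range.1 hm
      split_ifs with hiA
      · exact (hpiece m hm' i hiA).le
      · exact integral_nonneg fun w => by rw [hg]; exact indicator_nonneg (fun _ _ => norm_nonneg _) _
    -- the slab integral of `gᵢ` by the integrated Young bound
    have hGi : ∀ i ∈ s, (∫ w in Icc t₁ t₂ ×ˢ (univ : Set (EuclideanSpace ℝ (Fin 3))), g i w) ≤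
        r i ^ 2 * W + (r i)⁻¹ * (256 * vB * r i ^ 5) := by
      intro i hi
      have hr0 := (hr i hi).1
      set G : Set (ℝ × EuclideanSpace ℝ (Fin 3)) := (Ei i ×ˢ Bq i) ∩ (Icc t₁ t₂ ×ˢ univ) with hG
      have hGm : MeasurableSet G := (hEBm i).inter (measurableSet_Icc.prod MeasurableSet.univ)
      have hGsub : G ⊆ Icc t₁ t₂ ×ˢ ball (0 : EuclideanSpace ℝ (Fin 3)) (2 * R) := by
        rintro w ⟨⟨-, -, hw2⟩, hw1, -⟩; exact ⟨hw1, hw2⟩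
      have heq : (∫ w in Icc t₁ t₂ ×ˢ (univ : Set (EuclideanSpace ℝ (Fin 3))), g i w) = ∫ w in G, ‖U' w.1 w.2‖ := by
        rw [hg, integral_indicator (hEBm i), Measure.restrict_restrict (hEBm i)]
      rw [heq, integral_norm_eq_lintegral_enorm (f := fun w : ℝ × EuclideanSpace ℝ (Fin 3) => U' w.1 w.2) hU'm.restrict]
      have hY := lintegral_enorm_le_sq_cube_add (E := G) U' hr0
      have hW' : (∫⁻ w in G, ‖U' w.1 w.2‖ₑ ^ (3 : ℕ)) ≤
          ∫⁻ w in Icc t₁ t₂ ×ˢ ball (0 : EuclideanSpace ℝ (Fin 3)) (2 * R), ‖U' w.1 w.2‖ₑ ^ (3 : ℕ) :=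
        lintegral_mono_set hGsub
      have hvolG : volume G ≤ ENNReal.ofReal (256 * vB * r i ^ 5) := by
        calc volume G ≤ volume (Ei i ×ˢ ball (z i).2 (4 * r i)) :=
              measure_mono (fun w hw => ⟨hw.1.1, hw.1.2.1⟩)
          _ = ENNReal.ofReal (4 * r i ^ 2) * volume (ball (z i).2 (4 * r i)) := by
              rw [show (volume : Measure (ℝ × EuclideanSpace ℝ (Fin 3))) = (volume : Measure ℝ).prod volume from rfl,
                Measure.prod_prod, hEi, Real.volume_Icc]
              congr 1; congr 1; ring
          _ = ENNReal.ofReal (256 * vB * r i ^ 5) := by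
              rw [← ofReal_measureReal measure_ball_lt_top.ne, volumeReal_ball_four_mul _ hr0.le,
                ← ENNReal.ofReal_mul (by positivity)]
              congr 1; rw [hvB]; ring
      have hfin1 : ENNReal.ofReal (r i ^ 2) * (∫⁻ w in G, ‖U' w.1 w.2‖ₑ ^ (3 : ℕ)) ≠ ⊤ :=
        ENNReal.mul_ne_top ENNReal.ofReal_ne_top (ne_top_of_le_ne_top hU3'.ne hW')
      have hfin2 : ENNReal.ofReal (r i)⁻¹ * volume G ≠ ⊤ :=
        ENNReal.mul_ne_top ENNReal.ofReal_ne_top (ne_top_of_le_ne_top ENNReal.ofReal_ne_top hvolG)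
      calc (∫⁻ w in G, ‖U' w.1 w.2‖ₑ).toReal
          ≤ (ENNReal.ofReal (r i ^ 2) * (∫⁻ w in G, ‖U' w.1 w.2‖ₑ ^ (3 : ℕ)) + ENNReal.ofReal (r i)⁻¹ * volume G).toReal :=
            ENNReal.toReal_mono (ENNReal.add_ne_top.2 ⟨hfin1, hfin2⟩) hY
        _ = r i ^ 2 * (∫⁻ w in G, ‖U' w.1 w.2‖ₑ ^ (3 : ℕ)).toReal + (r i)⁻¹ * (volume G).toReal := by
            rw [ENNReal.toReal_add hfin1 hfin2, ENNReal.toReal_mul, ENNReal.toReal_mul,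
              ENNReal.toReal_ofReal (by positivity), ENNReal.toReal_ofReal (by positivity)]
        _ ≤ r i ^ 2 * W + (r i)⁻¹ * (256 * vB * r i ^ 5) := by
            have h1 : (∫⁻ w in G, ‖U' w.1 w.2‖ₑ ^ (3 : ℕ)).toReal ≤ W := ENNReal.toReal_mono hU3'.ne hW'
            have h2 : (volume G).toReal ≤ 256 * vB * r i ^ 5 :=
              (ENNReal.toReal_mono ENNReal.ofReal_ne_top hvolG).trans (by rw [ENNReal.toReal_ofReal (by positivity)])
            have h3 : 0 ≤ (r i)⁻¹ := inv_nonneg.2 hr0.le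
            nlinarith [mul_le_mul_of_nonneg_left h1 (sq_nonneg (r i)), mul_le_mul_of_nonneg_left h2 h3]
    -- per piece: the (e2) bound of record
    have hstep : ∀ m ∈ Finset.range p, (∫ w in Icc (τ m) (τ (m + 1)) ×ˢ (univ : Set (EuclideanSpace ℝ (Fin 3))),
        η w.1 * (H (Φ' w.1 w.2) * |inner ℝ (U' w.1 w.2) ((Θ w.2 ^ 2) • gradient (fun y => φ m y ^ 2) w.2)|)) ≤
        K₂ * ∑ i ∈ s, (r i)⁻¹ * (if i ∈ A m then ∫ w in Icc (τ m) (τ (m + 1)) ×ˢ Bq i, ‖U' w.1 w.2‖ else 0) := by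
      intro m hm
      have hm' := Finset.mem_range.1 hm
      have h := (G2 m hm').2
      rw [← hφsq m] at h
      have habs : (fun w : ℝ × EuclideanSpace ℝ (Fin 3) => η w.1 * (H (Φ' w.1 w.2) *
          |inner ℝ (U' w.1 w.2) ((Θ w.2 ^ 2) • gradient (fun y => φ m y ^ 2) w.2)|)) =
          fun w => |η w.1 * (H (Φ' w.1 w.2) *
            inner ℝ (U' w.1 w.2) ((Θ w.2 ^ 2) • gradient (fun y => φ m y ^ 2) w.2))| := by
        funext w
        rw [abs_mul (η w.1), abs_mul (H (Φ' w.1 w.2)), abs_of_nonneg (hη0 _), abs_of_nonneg (hH0 _)]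
      rw [habs]
      refine h.trans (mul_le_mul_of_nonneg_left ?_ hK₂)
      rw [← Finset.sum_filter_add_sum_filter_not s (fun i => i ∈ A m)]
      have hfil : s.filter (fun i => i ∈ A m) = A m := by
        ext i; rw [Finset.mem_filter]; exact ⟨fun h => h.2, fun h => ⟨hAs m h, h⟩⟩
      rw [hfil]
      have hzero : ∑ i ∈ s.filter (fun i => i ∉ A m), (r i)⁻¹ *
          (if i ∈ A m then ∫ w in Icc (τ m) (τ (m + 1)) ×ˢ Bq i, ‖U' w.1 w.2‖ else 0) = 0 :=
        Finset.sum_eq_zero fun i hi => by rw [if_neg (Finset.mem_filter.1 hi).2, mul_zero]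
      rw [hzero, add_zero]
      refine le_of_eq (Finset.sum_congr rfl fun i hi => ?_)
      rw [if_pos hi]
    refine (Finset.sum_le_sum hstep).trans ?_
    rw [← Finset.mul_sum, Finset.sum_comm]
    have hin : ∀ i ∈ s, ∑ m ∈ Finset.range p, (r i)⁻¹ *
        (if i ∈ A m then ∫ w in Icc (τ m) (τ (m + 1)) ×ˢ Bq i, ‖U' w.1 w.2‖ else 0) ≤ (W + 256 * vB) * r i := by
      intro i hi
      have hr0 := (hr i hi).1
      have hr1 := (hr i hi).2
      rw [← Finset.mul_sum]
      calc (r i)⁻¹ * ∑ m ∈ Finset.range p,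
            (if i ∈ A m then ∫ w in Icc (τ m) (τ (m + 1)) ×ˢ Bq i, ‖U' w.1 w.2‖ else 0)
          ≤ (r i)⁻¹ * (r i ^ 2 * W + (r i)⁻¹ * (256 * vB * r i ^ 5)) :=
            mul_le_mul_of_nonneg_left ((hsumg i hi).trans (hGi i hi)) (inv_nonneg.2 hr0.le)
        _ = W * r i + 256 * vB * r i ^ 3 := by field_simp
        _ ≤ (W + 256 * vB) * r i := by
            have : r i ^ 3 ≤ r i := by nlinarith [mul_pos hr0 hr0]
            nlinarith [mul_le_mul_of_nonneg_left this (by positivity : (0:ℝ) ≤ 256 * vB)]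
    calc K₂ * ∑ i ∈ s, ∑ m ∈ Finset.range p, (r i)⁻¹ *
          (if i ∈ A m then ∫ w in Icc (τ m) (τ (m + 1)) ×ˢ Bq i, ‖U' w.1 w.2‖ else 0)
        ≤ K₂ * ∑ i ∈ s, (W + 256 * vB) * r i := mul_le_mul_of_nonneg_left (Finset.sum_le_sum hin) hK₂
      _ = K₂ * (W + 256 * vB) * ∑ i ∈ s, r i := by rw [← Finset.mul_sum]; ring
      _ ≤ K₂ * (W + 256 * vB) * ε := mul_le_mul_of_nonneg_left hsum (by positivity)
      _ ≤ ω ε := by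
          rw [hωdef]
          have : 0 ≤ (4 * K₁ * ε + 4 * K₃) * ε := by positivity
          nlinarith
  · -- ### (e3): `Σ_m ∫ |e₃| ≤ K₃ Σ_m |L_m| Σ_{A m} rᵢ ≤ 4K₃ Σ rᵢ³ ≤ 4K₃ ε`
    have hstep : ∀ m ∈ Finset.range p, (∫ w in Icc (τ m) (τ (m + 1)) ×ˢ (univ : Set (EuclideanSpace ℝ (Fin 3))),
        η w.1 * (2 / cylRadius w.2 * (H (Φ' w.1 w.2) * |Θ w.2 ^ 2 * fderiv ℝ (fun y => φ m y ^ 2) w.2 (eR w.2)|))) ≤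
        K₃ * ((τ (m + 1) - τ m) * ∑ i ∈ s.filter (fun i => (z i).1 - 2 * r i ^ 2 ≤ τ m ∧
          τ (m + 1) ≤ (z i).1 + 2 * r i ^ 2), r i) := by
      intro m hm
      have hm' := Finset.mem_range.1 hm
      have h := (G3 m hm').2
      rw [← hφsq m] at h
      rw [← hA m]
      have habs : (fun w : ℝ × EuclideanSpace ℝ (Fin 3) => η w.1 * (2 / cylRadius w.2 * (H (Φ' w.1 w.2) *
          |Θ w.2 ^ 2 * fderiv ℝ (fun y => φ m y ^ 2) w.2 (eR w.2)|))) =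
          fun w => |η w.1 * (2 / cylRadius w.2 * (H (Φ' w.1 w.2) *
            (Θ w.2 ^ 2 * fderiv ℝ (fun y => φ m y ^ 2) w.2 (eR w.2))))| := by
        funext w
        have hρ : 0 ≤ 2 / cylRadius w.2 := div_nonneg zero_le_two (cylRadius_nonneg _)
        rw [abs_mul (η w.1), abs_mul (2 / cylRadius w.2), abs_mul (H (Φ' w.1 w.2)),
          abs_of_nonneg (hη0 _), abs_of_nonneg hρ, abs_of_nonneg (hH0 _)]
      rw [habs]
      calc _ ≤ K₃ * (τ (m + 1) - τ m) * ∑ i ∈ A m, r i := h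
        _ = K₃ * ((τ (m + 1) - τ m) * ∑ i ∈ A m, r i) := by ring
    refine (Finset.sum_le_sum hstep).trans ?_
    rw [← Finset.mul_sum]
    have hacc := sum_steps_active_weight_le hτ p s (fun i => (z i).1 - 2 * r i ^ 2) (fun i => (z i).1 + 2 * r i ^ 2)
      (fun i hi => by have := (hr i hi).1; nlinarith) r (fun i hi => (hr i hi).1.le)
    have h4 : ∑ i ∈ s, ((z i).1 + 2 * r i ^ 2 - ((z i).1 - 2 * r i ^ 2)) * r i ≤ 4 * ε := by
      have : ∀ i ∈ s, ((z i).1 + 2 * r i ^ 2 - ((z i).1 - 2 * r i ^ 2)) * r i ≤ 4 * r i := by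
        intro i hi; have h1 := (hr i hi).2; have h0 := (hr i hi).1; nlinarith [mul_pos h0 h0]
      refine (Finset.sum_le_sum this).trans ?_
      rw [← Finset.mul_sum]; linarith
    calc K₃ * ∑ m ∈ Finset.range p, (τ (m + 1) - τ m) *
          ∑ i ∈ s.filter (fun i => (z i).1 - 2 * r i ^ 2 ≤ τ m ∧ τ (m + 1) ≤ (z i).1 + 2 * r i ^ 2), r i
        ≤ K₃ * (4 * ε) := mul_le_mul_of_nonneg_left (hacc.trans h4) hK₃
      _ ≤ ω ε := by
          rw [hωdef]
          have : 0 ≤ (4 * K₁ * ε + K₂ * (W + 256 * vB)) * ε := by positivity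
          nlinarith

end Summit.NavierStokesRegularity.NavierStokesRegularity.Theorems.AxisymmetricKatoGlobal.EulerScaling

end
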